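import Literature.Analysis.Complex.PlaneDomainUniformization
import Literature.Analysis.Complex.PlaneDomainCoveringCriterion
import Literature.Analysis.Complex.PlaneDomainLambdaTransport
import Literature.Analysis.Complex.PlaneDomainExtremalMap
import Literature.Analysis.Complex.SchottkyMontelNormality
import Literature.Analysis.Complex.PlaneDomainExtremalDiscLift
import HarnessLib

/-!
# Uniformization of plane domains: the assembly (Fisher–Hubbard–Wittner)

PROOF-ONLY file (no definitions; abc-iut cell, seat abc-iut-w5-d089 gen 8, capstone «UNIF-G1P · ASSEMBLY» of
abc-iut-L4-t8's programme behind the named fact `Complex.PlaneDomainDiscCovering`, GAP row G-L4t8g7-1).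
Y. Fisher, J. H. Hubbard, B. S. Wittner, *A proof of the uniformization theorem for arbitrary plane domains*,
Proc. Amer. Math. Soc. **104** (1988) 413–418, Theorem p. 413.  The bricks of the tree are chained:

* N1a `Complex.locallyBounded_of_mapsTo_compl_zero_one` (Schottky: the based family of holomorphic maps
  `𝔻 → ℂ ∖ {0,1}` is locally bounded; affinely renormalised here to `ℂ ∖ {a, b}`);
* N1b `Complex.exists_norm_deriv_max_of_locallyBounded` (an extremal map `F : 𝔻 → U`, `F 0 = u₀`,
  maximising `‖f′(0)‖`, exists);
* `Complex.exists_lambdaChart` (FHW Lemma 3.1: the chart `Λ : 𝔻 → ℂ ∖ {a, b}`, `Λ 0 = u₀`, with based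
  holomorphic disc-lifting), the based lift `F₀` of `F`, the component `U₀ ∋ 0` of `𝔻 ∩ Λ⁻¹(U)`, and
  `Complex.norm_deriv_le_of_extremal_lift` (extremality descends to `F₀ : 𝔻 → U₀ ⊆ 𝔻`);
* N1c-TOWER `Complex.exists_discLift_of_extremal` (FHW Parts (b)(c): the Koebe square-root tower driven
  by the extremal `F₀` gives based disc-lifting for `F₀`; abc-iut-w5-d038);
* `Complex.discLift_comp`, `Complex.holomorphicSections_of_discLift` (disc-lifting ascends to `F = Λ ∘ F₀`
  and yields holomorphic sections over discs) and N1c-CRITERION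
  `Complex.surjOn_and_isCoveringMap_of_holomorphicSections` (sections ⇒ `F(𝔻) = U` and `F : 𝔻 → U` is a
  covering map).

* `Complex.planeDomainDiscCovering_of_extremalDiscLift` — `PlaneDomainDiscCovering` from the disc-lifting
  property of extremal maps into sub-domains of the disc (the assembly, with that property as hypothesis);
* **`Complex.planeDomainDiscCovering_holds`** — the named fact `Complex.PlaneDomainDiscCovering` DISCHARGED:
  every connected open `U ⊆ ℂ` whose complement contains two points is holomorphically covered by the unit
  disc (Koebe 1908 / Poincaré 1907; Fisher–Hubbard–Wittner 1988).

Classical mathematics; nothing here touches [IUTchIII] Cor. 3.12.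
[cite: FisherHubbardWittner1988, Theorem p.413]
-/

noncomputable section

open Set Metric Filter Topology Function

namespace Complex

/-- **Uniformization of plane domains, modulo the disc-lifting property of extremal maps** (FHW 1988,
Theorem p. 413, assembled): IF for every open preconnected `U₀ ⊆ 𝔻` containing `0` every holomorphic
`F₀ : 𝔻 → U₀` with `F₀ 0 = 0` maximising `‖f′(0)‖` over that family has the based disc-lifting property
(FHW Parts (b)(c), the square-root tower), THEN every connected open `U ⊆ ℂ` omitting two points is
holomorphically covered by the unit disc. [cite: FisherHubbardWittner1988, Theorem p.413] -/
theorem planeDomainDiscCovering_of_extremalDiscLift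
    (hK3 : ∀ (U₀ : Set ℂ), IsOpen U₀ → IsPreconnected U₀ → U₀ ⊆ ball (0 : ℂ) 1 → (0 : ℂ) ∈ U₀ →
      ∀ F₀ : ℂ → ℂ, DifferentiableOn ℂ F₀ (ball 0 1) → MapsTo F₀ (ball 0 1) U₀ → F₀ 0 = 0 →
        (∀ g : ℂ → ℂ, DifferentiableOn ℂ g (ball 0 1) → MapsTo g (ball 0 1) U₀ → g 0 = 0 →
          ‖deriv g 0‖ ≤ ‖deriv F₀ 0‖) →
        ∀ g : ℂ → ℂ, DifferentiableOn ℂ g (ball 0 1) → MapsTo g (ball 0 1) U₀ →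
          ∀ y ∈ ball (0 : ℂ) 1, F₀ y = g 0 →
            ∃ gl : ℂ → ℂ, DifferentiableOn ℂ gl (ball 0 1) ∧ MapsTo gl (ball 0 1) (ball 0 1) ∧
              gl 0 = y ∧ ∀ t ∈ ball (0 : ℂ) 1, F₀ (gl t) = g t) :
    PlaneDomainDiscCovering := by
  intro U hU hUc hab
  obtain ⟨a, b, hab, haU, hbU⟩ := hab
  obtain ⟨u₀, hu₀⟩ := hUc.nonempty
  have hua : u₀ ≠ a := fun h => haU (h ▸ hu₀)
  have hub : u₀ ≠ b := fun h => hbU (h ▸ hu₀)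
  have hba : b - a ≠ 0 := sub_ne_zero.mpr hab.symm
  have hA0 : ∀ w : ℂ, (w - a) / (b - a) = 0 ↔ w = a := fun w => by
    rw [div_eq_zero_iff, or_iff_left hba, sub_eq_zero]
  have hA1 : ∀ w : ℂ, (w - a) / (b - a) = 1 ↔ w = b := fun w => by
    rw [div_eq_one_iff_eq hba, sub_left_inj]
  /- N1a: the based family of holomorphic maps `𝔻 → U` is locally bounded -/
  have hbdd : ∀ c ∈ ball (0 : ℂ) 1, ∃ M : ℝ, ∃ r > 0, ∀ f : ℂ → ℂ,
      DifferentiableOn ℂ f (ball 0 1) → MapsTo f (ball 0 1) U → f 0 = u₀ →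
        ∀ z ∈ ball c r ∩ ball 0 1, ‖f z‖ ≤ M := by
    intro c hc
    obtain ⟨M, s, hs, hM⟩ := locallyBounded_of_mapsTo_compl_zero_one
      (u₀ := (u₀ - a) / (b - a)) (fun h => hua ((hA0 u₀).mp h)) (fun h => hub ((hA1 u₀).mp h)) hc
    refine ⟨‖a‖ + ‖b - a‖ * M, s, hs, fun f hf hfU hf0 z hz => ?_⟩
    have hAf : DifferentiableOn ℂ (fun w => (f w - a) / (b - a)) (ball 0 1) :=
      (hf.sub_const a).div_const _
    have hAf01 : ∀ w ∈ ball (0 : ℂ) 1, (f w - a) / (b - a) ≠ 0 ∧ (f w - a) / (b - a) ≠ 1 :=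
      fun w hw => ⟨fun h => haU (((hA0 _).mp h) ▸ hfU hw), fun h => hbU (((hA1 _).mp h) ▸ hfU hw)⟩
    have hAf0 : (f 0 - a) / (b - a) = (u₀ - a) / (b - a) := by rw [hf0]
    have key : ‖(f z - a) / (b - a)‖ ≤ M := hM _ hAf hAf01 hAf0 z hz
    have hfz : f z = a + (b - a) * ((f z - a) / (b - a)) := by
      field_simp
      ring
    calc ‖f z‖ = ‖a + (b - a) * ((f z - a) / (b - a))‖ := by rw [← hfz]
      _ ≤ ‖a‖ + ‖(b - a) * ((f z - a) / (b - a))‖ := norm_add_le _ _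
      _ = ‖a‖ + ‖b - a‖ * ‖(f z - a) / (b - a)‖ := by rw [norm_mul]
      _ ≤ ‖a‖ + ‖b - a‖ * M := by gcongr
  /- N1b: an extremal map -/
  obtain ⟨F, hF, hFU, hF0, hmax⟩ := exists_norm_deriv_max_of_locallyBounded hu₀ hbdd
  have hmax' : ∀ g : ℂ → ℂ, DifferentiableOn ℂ g (ball 0 1) → MapsTo g (ball 0 1) U → g 0 = F 0 →
      ‖deriv g 0‖ ≤ ‖deriv F 0‖ := fun g hg hgU hg0 => hmax g hg hgU (hg0.trans hF0)
  /- the `λ`-chart at `u₀` and the based lift `F₀` of `F` -/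
  obtain ⟨Λ, hΛd, hΛab, hΛ0, hΛlift⟩ := exists_lambdaChart hab hua hub
  have hΛliftU : ∀ g : ℂ → ℂ, DifferentiableOn ℂ g (ball 0 1) → MapsTo g (ball 0 1) U →
      ∀ y ∈ ball (0 : ℂ) 1, Λ y = g 0 →
        ∃ gl : ℂ → ℂ, DifferentiableOn ℂ gl (ball 0 1) ∧ MapsTo gl (ball 0 1) (ball 0 1) ∧
          gl 0 = y ∧ ∀ t ∈ ball (0 : ℂ) 1, Λ (gl t) = g t :=
    fun g hg hgU y hy h => hΛlift g hg
      (fun t ht => ⟨fun h' => haU (h' ▸ hgU ht), fun h' => hbU (h' ▸ hgU ht)⟩) y hy h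
  obtain ⟨F₀, hF₀d, hF₀D, hF₀0, hΛF₀⟩ :=
    hΛliftU F hF hFU 0 (mem_ball_self one_pos) (by rw [hΛ0, hF0])
  /- the component `U₀ ∋ 0` of `𝔻 ∩ Λ⁻¹(U)` -/
  have h0S : (0 : ℂ) ∈ ball (0 : ℂ) 1 ∩ Λ ⁻¹' U :=
    ⟨mem_ball_self one_pos, by show Λ 0 ∈ U; rw [hΛ0]; exact hu₀⟩
  have hU₀o : IsOpen (connectedComponentIn (ball (0 : ℂ) 1 ∩ Λ ⁻¹' U) 0) :=
    (hΛd.continuousOn.isOpen_inter_preimage isOpen_ball hU).connectedComponentIn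
  have hU₀c : IsPreconnected (connectedComponentIn (ball (0 : ℂ) 1 ∩ Λ ⁻¹' U) 0) :=
    isPreconnected_connectedComponentIn
  have hU₀D : connectedComponentIn (ball (0 : ℂ) 1 ∩ Λ ⁻¹' U) 0 ⊆ ball 0 1 :=
    (connectedComponentIn_subset _ _).trans inter_subset_left
  have h0U₀ : (0 : ℂ) ∈ connectedComponentIn (ball (0 : ℂ) 1 ∩ Λ ⁻¹' U) 0 :=
    mem_connectedComponentIn h0S
  have hΛU₀ : MapsTo Λ (connectedComponentIn (ball (0 : ℂ) 1 ∩ Λ ⁻¹' U) 0) U :=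
    fun z hz => (connectedComponentIn_subset _ _ hz).2
  have hF₀U₀ : MapsTo F₀ (ball 0 1) (connectedComponentIn (ball (0 : ℂ) 1 ∩ Λ ⁻¹' U) 0) :=
    mapsTo_connectedComponentIn_of_continuousOn hF₀d.continuousOn
      (fun z hz => ⟨hF₀D hz, by show Λ (F₀ z) ∈ U; rw [hΛF₀ z hz]; exact hFU hz⟩)
      (by rw [hF₀0]; exact h0U₀)
  /- extremality descends to `F₀` -/
  have hΛ'0 : deriv Λ 0 ≠ 0 :=
    deriv_ne_zero_of_discLift hU hΛd hΛliftU (mem_ball_self one_pos) (by rw [hΛ0]; exact hu₀)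
  have hmax₀ := norm_deriv_le_of_extremal_lift hΛd hΛ'0 hU₀D hΛU₀ hmax' hF₀d hF₀0 hΛF₀
  /- N1c-TOWER: disc-lifting for `F₀`; ascend; sections; criterion -/
  have hF₀lift := hK3 _ hU₀o hU₀c hU₀D h0U₀ F₀ hF₀d hF₀U₀ hF₀0 hmax₀
  have hFlift := discLift_comp hΛliftU hF₀U₀ hF₀lift hΛF₀
  have hsec := holomorphicSections_of_discLift (U := U) hFlift
  obtain ⟨hsurj, hcov⟩ :=
    surjOn_and_isCoveringMap_of_holomorphicSections hU hUc.isPreconnected hF hFU hsec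
  exact ⟨F, hF, hsurj, hFU, hcov⟩

/-- **Uniformization of plane domains** (Koebe–Poincaré; Fisher–Hubbard–Wittner 1988, Theorem p. 413:
"if `U ⊂ ℂ` is a connected open set whose complement contains at least two points, then the universal
covering space of `U` is the disc"): the named fact `Complex.PlaneDomainDiscCovering` holds — for every
connected open `U ⊆ ℂ` omitting two points there is `f : ℂ → ℂ`, holomorphic on the unit disc, mapping it
ONTO `U`, whose restriction `𝔻 → U` is a covering map. [cite: FisherHubbardWittner1988, Theorem p.413] -/
theorem planeDomainDiscCovering_holds : PlaneDomainDiscCovering :=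
  planeDomainDiscCovering_of_extremalDiscLift
    fun _ hUo _ hU h0 _ hF hFU hF0 hmax _ hg hgU _ hy hyg =>
      exists_discLift_of_extremal hUo hU h0 hF hFU hF0 hmax hg hgU hy hyg

/-- `PlaneDomainDiscCovering` — `_holds` alias of `planeDomainDiscCovering_holds` above under the fact's exact name (appended
2026-08-28, D-0026 bookkeeping: the proof term is the existing theorem of this file; no statement,
definition or attribute is edited; no new named fact; the ledger's debt table listed the fact
unproved). [cite: FisherHubbardWittner1988, Theorem p.413] -/
theorem _root_.Complex.PlaneDomainDiscCovering_holds : PlaneDomainDiscCovering :=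
  _root_.Complex.planeDomainDiscCovering_holds

end Complex

end
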